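import Summits.NavierStokesRegularity.NavierStokesRegularity.Theorems.EpisodeInduction.Negative.ShiftStage

/-!
# K48/K49 kernel (Phase D, part 2): the re-timing lever is DEAD under the GLOBAL ANCHOR (register v2.3′)

Cell `ns-blowup`, seat `ns-blowup-refuter` (g9). Companion of `ShiftStage.lean` (the lever `S.shift E`
against the UN-anchored inductions K2Q/K2R). LABEL: refuter kernel certificate; negative-side support
lemmas for the route item `EpisodeInduction` (:= `EpisodeInductionG`). WHAT THIS IS NOT: not
Navier–Stokes evidence, no `¬ EpisodeInductionG` is claimed, nothing constructed.

§6 Under the registered margin `Margins.routeG` (module `PalasekTowerRegisterGlobal`, p411629) the GLOBAL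
level-0 anchor `Schedule.AnchorGlobal S u : ∀ t ∈ [0, τ 0), ∀ x, ‖u t x‖ < c₁ Y₀` makes the K2 hypothesis
over every proper forward translate `S.shift E` of a schedule carrying a stage EMPTY
(`Schedule.AnchorGlobal.not_shift`, hU-free; `Stage.isEmpty_routeG_shift`, with hU :=
`tao_unconditional_uniqueness_velocity_forced`).
§7 Given hU, two schedules with the SAME datum and force that each carry a `routeG`-stage have the same
readout times and the same blow-up time (`Stage.τ_eq_of_same_data`, `Stage.τ_eq_and_T_eq_of_same_data`):
the re-reading class of a design is a point — the `∀ S` of `EpisodeInductionG` ranges over DESIGNS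
`(u₀, f) ↦ τ`, not over re-readings of one flow.

References: S. Palasek, arXiv:2605.13827 §3.3–§4 [cite: Palasek2026ElementaryModel, §3.3];
T. Tao, Anal. PDE 6 (2013), Cor. 11.4 [cite: Tao2011, Cor. 11.4].
-/

noncomputable section

namespace Summit.NavierStokesRegularity.FluidComputer.PalasekTowerClayBridge

open Set MeasureTheory Filter Topology Function
open scoped ENNReal ContDiff NNReal
open Literature.Analysis.FluidPDE
open Summit.NavierStokesRegularity.NavierStokesRegularity

/-! ## §6 Under the ANCHOR OF RECORD (REGISTER v2.3′ = module `PalasekTowerRegisterGlobal`) the lever is dead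

REGISTER v2.3′ (module `PalasekTowerRegisterGlobal`, p411629; planner RULINGS K48/K49) conjoins to the
registered margin `Margins.routeG` the GLOBAL level-0 anchor
`Schedule.AnchorGlobal S u : ∀ t ∈ [0, τ 0), ∀ x, ‖u t x‖ < c₁ Y₀`. A field carrying the level-0 floor of
`S` at `τ 0` is then not anchored for any proper forward translate `S.shift E`, so — given hU, which
identifies the flows — the K2 hypothesis over every proper translate of a schedule that carries a stage
is EMPTY: the lever of §3–§5 does not touch `EpisodeInductionG`. The pointwise, `hU`-free form is the
tree's `Stage.τ_zero_le_of_anchorGlobal`. -/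

/-- **The anchor kills the re-timing lever.** A field with the level-0 floor of `S` at `τ 0` is NOT
anchored (`Schedule.AnchorGlobal`, v2.3′) for a proper forward translate `S.shift E`, `E > 0`. [folklore] -/
theorem Schedule.AnchorGlobal.not_shift {R : TowerRates} {S : Schedule R} (hQ : S.Quiet) {E : ℝ}
    (hE : 0 < E) {u : ℝ → EuclideanSpace ℝ (Fin 3) → EuclideanSpace ℝ (Fin 3)}
    (hfloor : ∃ x, ‖x‖ ≤ S.radius ∧ S.c₁ * R.Y 0 ≤ ‖u (S.τ 0) x‖) :
    ¬ (S.shift hQ hE.le).AnchorGlobal u := by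
  intro hA
  obtain ⟨x, -, hfl⟩ := hfloor
  have h := hA (S.τ 0) ⟨(S.τ_pos 0).le, by simp only [Schedule.shift_τ]; linarith⟩ x
  simp only [Schedule.shift_c₁] at h
  linarith

/-- Hence no stage of a proper translate with an anchored margin `Margins.withAnchorGlobal m'` shares its
velocity at `τ 0` with a stage of `S`. [folklore] -/
theorem Stage.not_withAnchorGlobal_shift {ν : ℝ} {R : TowerRates} {S : Schedule R} {m m' : Margins R}
    {k k' : ℕ} (s : Stage ν R S m k) (hQ : S.Quiet) {E : ℝ} (hE : 0 < E)
    (s' : Stage ν R (S.shift hQ hE.le) (Margins.withAnchorGlobal m') k')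
    (h0 : s'.u (S.τ 0) = s.u (S.τ 0)) : False := by
  refine Schedule.AnchorGlobal.not_shift hQ hE (u := s'.u) ?_ s'.margin.1
  obtain ⟨x, hx, hfl⟩ := s.floor 0 (Nat.zero_le k)
  exact ⟨x, hx, by rw [h0]; exact hfl⟩

/-- The same for the route margin of record `Margins.routeG R = withStrain (withAnchorGlobal (register R))`;
this is the tree's `Stage.τ_zero_le_of_anchorGlobal` read at the translate (`τ 0 + E ≤ τ 0` is absurd).
[folklore] -/
theorem Stage.not_routeG_shift {ν : ℝ} {R : TowerRates} {S : Schedule R} {m : Margins R}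
    {k k' : ℕ} (s : Stage ν R S m k) (hQ : S.Quiet) {E : ℝ} (hE : 0 < E)
    (s' : Stage ν R (S.shift hQ hE.le) (Margins.routeG R) k')
    (h0 : s'.u (S.τ 0) = s.u (S.τ 0)) : False := by
  have h := Stage.τ_zero_le_of_anchorGlobal s' s h0.symm (by simp only [Schedule.shift_c₁]; exact le_rfl)
  simp only [Schedule.shift_τ] at h
  linarith

/-- With hU the velocity agreement `h0` is automatic: a stage of `S` at level `k` and a stage of the
translate at level `k'` are classical finite-energy solutions of the same forced system from the same
datum on `[0, τ 0]`, hence agree there (`Stage` uniqueness). [cite: Tao2011, Cor. 11.4] -/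
theorem Stage.u_eq_at_τ_zero_of_shift (hU : tao_unconditional_uniqueness_velocity_forced) {ν : ℝ}
    (hν : 0 < ν) {R : TowerRates} {S : Schedule R} {m m' : Margins R} {k k' : ℕ}
    (s : Stage ν R S m k) (hQ : S.Quiet) {E : ℝ} (hE : 0 ≤ E)
    (s' : Stage ν R (S.shift hQ hE) m' k') : s'.u (S.τ 0) = s.u (S.τ 0) := by
  have hτ : 0 < S.τ 0 := S.τ_pos 0
  have hcl : IsClassicalNSSolutionOn (Icc 0 (S.τ 0)) ν S.f s.u s.p :=
    s.classical.mono (Icc_subset_Icc le_rfl (S.τ_mono (Nat.zero_le k))) (uniqueDiffOn_Icc hτ)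
  have hle' : S.τ 0 ≤ S.τ k' + E := (S.τ_mono (Nat.zero_le k')).trans (le_add_of_nonneg_right hE)
  have hcl' : IsClassicalNSSolutionOn (Icc 0 (S.τ 0)) ν S.f s'.u s'.p :=
    s'.classical.mono (Icc_subset_Icc le_rfl hle') (uniqueDiffOn_Icc hτ)
  have hC1 : ContDiff ℝ 1 S.u₀ := by
    rw [← s.initial]
    exact (s.classical.contDiff_velocity (t := 0) ⟨le_rfl, (S.τ_pos k).le⟩).of_le (by norm_cast)
  obtain ⟨hL2, hH1⟩ := Theorems.ClayUniqueness.memLp_two_of_rapidDecay S.datum_decay hC1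
  have hEs : ∃ C : ℝ≥0∞, C < ⊤ ∧ ∀ t ∈ Icc 0 (S.τ 0), ∫⁻ x, ‖s.u t x‖ₑ ^ 2 ≤ C := by
    obtain ⟨C, hC, hb⟩ := s.energy
    exact ⟨C, hC, fun t ht => hb t ⟨ht.1, ht.2.trans (S.τ_mono (Nat.zero_le k))⟩⟩
  have hEs' : ∃ C : ℝ≥0∞, C < ⊤ ∧ ∀ t ∈ Icc 0 (S.τ 0), ∫⁻ x, ‖s'.u t x‖ₑ ^ 2 ≤ C := by
    obtain ⟨C, hC, hb⟩ := s'.energy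
    exact ⟨C, hC, fun t ht => hb t ⟨ht.1, ht.2.trans hle'⟩⟩
  exact hU ν (S.τ 0) hν hτ S.u₀ hL2 hH1 S.f S.force_smooth S.force_decay s'.u s.u s'.p s.p hcl' hcl
    s'.initial s.initial hEs' hEs (S.τ 0) ⟨hτ.le, le_rfl⟩

/-- **Dead lever, anchored margins**: given hU, a schedule carrying a stage has NO stage of any proper
forward translate for an anchored margin `Margins.withAnchorGlobal m'`. [cite: Tao2011, Cor. 11.4] -/
theorem Stage.isEmpty_withAnchorGlobal_shift (hU : tao_unconditional_uniqueness_velocity_forced) {ν : ℝ}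
    (hν : 0 < ν) {R : TowerRates} {S : Schedule R} {m m' : Margins R} {k k' : ℕ}
    (s : Stage ν R S m k) (hQ : S.Quiet) {E : ℝ} (hE : 0 < E) :
    IsEmpty (Stage ν R (S.shift hQ hE.le) (Margins.withAnchorGlobal m') k') :=
  ⟨fun s' => s.not_withAnchorGlobal_shift hQ hE s' (s.u_eq_at_τ_zero_of_shift hU hν hQ hE.le s')⟩

/-- **Dead lever, route margin of record**: given hU, a schedule carrying a stage has NO `routeG`-stage
of any proper forward translate — the K48 lever does not touch `EpisodeInductionG`.
[cite: Tao2011, Cor. 11.4] -/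
theorem Stage.isEmpty_routeG_shift (hU : tao_unconditional_uniqueness_velocity_forced) {ν : ℝ}
    (hν : 0 < ν) {R : TowerRates} {S : Schedule R} {m : Margins R} {k k' : ℕ}
    (s : Stage ν R S m k) (hQ : S.Quiet) {E : ℝ} (hE : 0 < E) :
    IsEmpty (Stage ν R (S.shift hQ hE.le) (Margins.routeG R) k') :=
  ⟨fun s' => s.not_routeG_shift hQ hE s' (s.u_eq_at_τ_zero_of_shift hU hν hQ hE.le s')⟩

/-! ## §7 The re-reading class of a design is a point (given hU; REGISTER v2.3′)

With the global anchor, `τ 0` is a functional of the flow (`Stage.τ_zero_le_of_anchorGlobal`, pointwise), and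
with rigidity so is every readout. Given hU the flow is a functional of (datum, force): so two schedules
with the SAME datum and force, each carrying a `routeG`-stage (any levels, any balls, any clocks, any
`T`), have the same readout sequence — the `∀ S` of `EpisodeInductionG` ranges over designs
`(u₀, f) ↦ τ`, not over re-readings (refuter K49 (B), planner RULING K49 (1)). -/

/-- Velocity agreement from hU up to the earlier of two first readouts: a `routeG`-stage of `S` and a
stage of `S'` (any margin) from the same datum and force agree at `S'.τ 0` provided
`S'.τ 0 ≤ S.τ k` (so that both are classical on `[0, S'.τ 0]`). [cite: Tao2011, Cor. 11.4] -/
theorem Stage.u_eq_of_same_data (hU : tao_unconditional_uniqueness_velocity_forced) {ν : ℝ}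
    (hν : 0 < ν) {R : TowerRates} {S S' : Schedule R} {m m' : Margins R} {k k' : ℕ}
    (hu₀ : S'.u₀ = S.u₀) (hf : S'.f = S.f) (s : Stage ν R S m k) (s' : Stage ν R S' m' k')
    {t : ℝ} (ht : 0 ≤ t) (htk : t ≤ S.τ k) (htk' : t ≤ S'.τ k') (htp : 0 < t) :
    s'.u t = s.u t := by
  have hcl : IsClassicalNSSolutionOn (Icc 0 t) ν S.f s.u s.p :=
    s.classical.mono (Icc_subset_Icc le_rfl htk) (uniqueDiffOn_Icc htp)
  have hcl' : IsClassicalNSSolutionOn (Icc 0 t) ν S.f s'.u s'.p := by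
    rw [← hf]
    exact s'.classical.mono (Icc_subset_Icc le_rfl htk') (uniqueDiffOn_Icc htp)
  have hC1 : ContDiff ℝ 1 S.u₀ := by
    rw [← s.initial]
    exact (s.classical.contDiff_velocity (t := 0) ⟨le_rfl, (S.τ_pos k).le⟩).of_le (by norm_cast)
  obtain ⟨hL2, hH1⟩ := Theorems.ClayUniqueness.memLp_two_of_rapidDecay S.datum_decay hC1
  have hEs : ∃ C : ℝ≥0∞, C < ⊤ ∧ ∀ r ∈ Icc 0 t, ∫⁻ x, ‖s.u r x‖ₑ ^ 2 ≤ C := by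
    obtain ⟨C, hC, hb⟩ := s.energy
    exact ⟨C, hC, fun r hr => hb r ⟨hr.1, hr.2.trans htk⟩⟩
  have hEs' : ∃ C : ℝ≥0∞, C < ⊤ ∧ ∀ r ∈ Icc 0 t, ∫⁻ x, ‖s'.u r x‖ₑ ^ 2 ≤ C := by
    obtain ⟨C, hC, hb⟩ := s'.energy
    exact ⟨C, hC, fun r hr => hb r ⟨hr.1, hr.2.trans htk'⟩⟩
  have hi' : s'.u 0 = S.u₀ := by rw [s'.initial, hu₀]
  exact hU ν t hν htp S.u₀ hL2 hH1 S.f S.force_smooth S.force_decay s'.u s.u s'.p s.p hcl' hcl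
    hi' s.initial hEs' hEs t ⟨ht, le_rfl⟩

/-- **`τ 0` is a functional of (datum, force)**, one direction: an anchored (`routeG`) stage of `S` and
any stage of `S'` with floor constant `≥ S.c₁`, from the same datum and force, satisfy
`S.τ 0 ≤ S'.τ 0` (given hU; any balls). [cite: Tao2011, Cor. 11.4] -/
theorem Stage.τ_zero_le_of_same_data (hU : tao_unconditional_uniqueness_velocity_forced) {ν : ℝ}
    (hν : 0 < ν) {R : TowerRates} {S S' : Schedule R} {m' : Margins R} {k k' : ℕ}
    (hu₀ : S'.u₀ = S.u₀) (hf : S'.f = S.f) (hc : S.c₁ ≤ S'.c₁)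
    (s : Stage ν R S (Margins.routeG R) k) (s' : Stage ν R S' m' k') : S.τ 0 ≤ S'.τ 0 := by
  by_contra hlt
  have hlt' : S'.τ 0 < S.τ 0 := lt_of_not_ge hlt
  have hu : s'.u (S'.τ 0) = s.u (S'.τ 0) :=
    Stage.u_eq_of_same_data hU hν hu₀ hf s s' (S'.τ_pos 0).le
      (hlt'.le.trans (S.τ_mono (Nat.zero_le k))) (S'.τ_mono (Nat.zero_le k')) (S'.τ_pos 0)
  exact hlt (Stage.τ_zero_le_of_anchorGlobal s s' hu hc)

/-- **The re-reading class is a point.** Two schedules with the same datum, force and floor constant,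
each carrying a `routeG`-stage (anchored, rigid), have the SAME readout sequence (given hU; any levels,
balls, clocks, `T`). For registered schedules `c₁ = 1` on both sides (`Schedule.Rigid.c₁_eq`).
[cite: Tao2011, Cor. 11.4] -/
theorem Stage.τ_eq_of_same_data (hU : tao_unconditional_uniqueness_velocity_forced) {ν : ℝ}
    (hν : 0 < ν) {R : TowerRates} {S S' : Schedule R} {k k' : ℕ}
    (hu₀ : S'.u₀ = S.u₀) (hf : S'.f = S.f)
    (s : Stage ν R S (Margins.routeG R) k) (s' : Stage ν R S' (Margins.routeG R) k') :
    S.τ = S'.τ := by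
  have hc : S.c₁ = S'.c₁ := by rw [s.routeG_rigid.c₁_eq, s'.routeG_rigid.c₁_eq]
  exact s.routeG_rigid.τ_eq_of_τ_zero_eq s'.routeG_rigid
    (le_antisymm (Stage.τ_zero_le_of_same_data hU hν hu₀ hf hc.le s s')
      (Stage.τ_zero_le_of_same_data hU hν hu₀.symm hf.symm hc.ge s' s))

/-- The blow-up time is pinned by the readouts (clock exhaustion `Schedule.exists_lt_τ`): schedules
with the same readout sequence have the same `T`. [folklore] -/
theorem Schedule.T_eq_of_τ_eq {R : TowerRates} {S S' : Schedule R} (h : S.τ = S'.τ) : S.T = S'.T := by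
  rcases lt_trichotomy S.T S'.T with hlt | heq | hgt
  · obtain ⟨n, hn⟩ := S'.exists_lt_τ hlt
    have := S.τ_lt_T (n + 1)
    rw [h] at this
    exact absurd hn (not_lt.2 this.le)
  · exact heq
  · obtain ⟨n, hn⟩ := S.exists_lt_τ hgt
    have := S'.τ_lt_T (n + 1)
    rw [← h] at this
    exact absurd hn (not_lt.2 this.le)

/-- **Corollary (the re-reading class is a point, full form).** Same datum, same force, a `routeG`-stage
on each side (given hU): same readouts AND same blow-up time. What may still differ — `c₃`, `c₄`, the
ball, label loops, `Φ` — enters no contradiction (refuter K49 (B): inert). [cite: Tao2011, Cor. 11.4] -/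
theorem Stage.τ_eq_and_T_eq_of_same_data (hU : tao_unconditional_uniqueness_velocity_forced) {ν : ℝ}
    (hν : 0 < ν) {R : TowerRates} {S S' : Schedule R} {k k' : ℕ}
    (hu₀ : S'.u₀ = S.u₀) (hf : S'.f = S.f)
    (s : Stage ν R S (Margins.routeG R) k) (s' : Stage ν R S' (Margins.routeG R) k') :
    S.τ = S'.τ ∧ S.T = S'.T :=
  have h := Stage.τ_eq_of_same_data hU hν hu₀ hf s s'
  ⟨h, Schedule.T_eq_of_τ_eq h⟩

end Summit.NavierStokesRegularity.FluidComputer.PalasekTowerClayBridge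

end
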